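import Summits.Parity.BatemanHorn.Theorems.NormalFamilyBound.Negative.RealAxis

/-!
# Crux `NormalFamilyBound` (stmt-Parity-9769), line `Sketch` (renewal-phase-bootstrap): stub `stub_bootstrapTransfer`

The BOOTSTRAP TRANSFER on R+: arc barrier + phase-velocity lower bound + real-axis order of magnitude give one
bound for `H_x(z)`, `x ≥ 3`, on `{0 < Re z < 7/4, |Im z| < η}`.
Everything here is PROVED (supports stmt-Parity-9769; registered stub of the line skeleton
`Cruxes/NormalFamilyBound/Lines/Sketch.lean`). Vocabulary `Ωf`, `H` of `Theorems/NormalFamilyBound/Negative/RealAxis.lean`.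

Proof layout: `S_x(w) = Σ_{n ≤ x} w^{Ω_f(n)}` is the complex polynomial `P = Σ_{n ≤ x} X^{Ω_f(n)}` evaluated at
`w`, and `w P'(w) = Σ Ω_f(n) w^{Ω_f(n)}` (`bootstrapTransfer_eval`, `bootstrapTransfer_mul_derivative_eval`);
`‖H_x(z)‖ = x⁻¹ (log x)^{k(1 − Re z)} ‖S_x(z)‖` and `H_x(conj z) = conj H_x(z)` (so WLOG `Im z ≥ 0`); then along
the arc `φ ↦ |z| e^{iφ}`, `0 ≤ φ ≤ arg z`, the barrier
`b(φ) = log S_x(|z|) + C⁺ φ − k |z| (1 − cos φ) log log x` starts at `‖S_x(|z|)‖ = e^{b(0)}` and its slope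
dominates `−Im(w P'/P)` wherever `‖P‖ > e^{b}` by the phase-velocity lower bound; the arc barrier hypothesis
gives `‖S_x(z)‖ ≤ e^{b(arg z)}`, and the real-axis order `S_x(r) ≤ C_r x (log x)^{k(r−1)}` turns this into
`‖H_x(z)‖ ≤ C_r e^{C⁺ π/2}` because `|z| cos (arg z) = Re z`.
-/

namespace Summit.Parity.BatemanHorn.Cruxes.NormalFamilyBound.RenewalPhaseBootstrap

open Literature.NumberTheory.Sieve Polynomial Finset Filter
open Summit.Parity.BatemanHorn.Theorems.NormalFamilyBound.Negative

noncomputable section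

/-- `H` in the vocabulary `Ωf` (definitional). -/
theorem bootstrapTransfer_H_eq (k : ℕ) (f : Fin k → ℤ[X]) (x : ℕ) (z : ℂ) :
    H k f x z = (x : ℂ)⁻¹ * Complex.exp ((k : ℂ) * (1 - z) * (Real.log (Real.log x) : ℂ)) *
      ∑ n ∈ Finset.range (x + 1), z ^ Ωf f n := rfl

/-- The norm of `H_x(z)`: `‖H_x(z)‖ = x⁻¹ (log x)^{k(1 − Re z)} ‖S_x(z)‖` (written with `exp`). -/
theorem bootstrapTransfer_norm_H (k : ℕ) (f : Fin k → ℤ[X]) (x : ℕ) (z : ℂ) :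
    ‖H k f x z‖ = (x : ℝ)⁻¹ * Real.exp ((k : ℝ) * (1 - z.re) * Real.log (Real.log x)) *
      ‖∑ n ∈ Finset.range (x + 1), z ^ Ωf f n‖ := by
  rw [bootstrapTransfer_H_eq, norm_mul, norm_mul, norm_inv, Complex.norm_natCast, Complex.norm_exp]
  congr 3
  simp only [Complex.mul_re, Complex.mul_im, Complex.sub_re, Complex.sub_im, Complex.one_re,
    Complex.one_im, Complex.ofReal_re, Complex.ofReal_im, Complex.natCast_re, Complex.natCast_im]
  ring

/-- Conjugation symmetry of the family: `H_x(conj z) = conj (H_x(z))` (all coefficients are real). -/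
theorem bootstrapTransfer_H_conj (k : ℕ) (f : Fin k → ℤ[X]) (x : ℕ) (z : ℂ) :
    H k f x ((starRingEnd ℂ) z) = (starRingEnd ℂ) (H k f x z) := by
  simp only [bootstrapTransfer_H_eq, map_mul, map_inv₀, map_natCast, map_sum, map_pow,
    ← Complex.exp_conj, map_sub, map_one, Complex.conj_ofReal]

/-- `S_x(w) = Σ_{n ≤ x} w^{Ω_f(n)}` is the value at `w` of the polynomial `Σ_{n ≤ x} X^{Ω_f(n)}`. -/
theorem bootstrapTransfer_eval {k : ℕ} (f : Fin k → ℤ[X]) (x : ℕ) (w : ℂ) :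
    (∑ n ∈ Finset.range (x + 1), (X : ℂ[X]) ^ Ωf f n).eval w =
      ∑ n ∈ Finset.range (x + 1), w ^ Ωf f n := by
  simp only [eval_finsetSum, eval_pow, eval_X]

/-- `w P'(w) = Σ_{n ≤ x} Ω_f(n) w^{Ω_f(n)}` for `P = Σ_{n ≤ x} X^{Ω_f(n)}`. -/
theorem bootstrapTransfer_mul_derivative_eval {k : ℕ} (f : Fin k → ℤ[X]) (x : ℕ) (w : ℂ) :
    w * (derivative (∑ n ∈ Finset.range (x + 1), (X : ℂ[X]) ^ Ωf f n)).eval w =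
      ∑ n ∈ Finset.range (x + 1), (Ωf f n : ℂ) * w ^ Ωf f n := by
  rw [derivative_sum, eval_finsetSum, Finset.mul_sum]
  refine Finset.sum_congr rfl fun n _ => ?_
  rw [derivative_X_pow, eval_mul, eval_C, eval_pow, eval_X]
  rcases Nat.eq_zero_or_pos (Ωf f n) with h | h
  · rw [h]
    simp
  · rw [mul_left_comm, mul_pow_sub_one h.ne']

/-- STUB (provable now): the BOOTSTRAP TRANSFER on R+. The arc barrier lemma, a phase-velocity lower bound on the
region `{0 < r ≤ 15/8, |θ| < π/2, |r sin θ| < η}` and the real-axis order of magnitude up to `r ≤ 15/8` give ONE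
bound `‖H_x(z)‖ ≤ M` for all `x ≥ 3` on `{0 < Re z < 7/4, |Im z| < η}` (arcs `|z| = r` from the real base point
`r = |z| ≤ √(49/16 + η²) ≤ 15/8`; barrier `b(φ) = log S_x(r) + C|φ| − k r (1 − cos φ) log log x`; the conclusion
`‖S_x(z)‖ ≤ e^{Cπ/2} S_x(|z|) (log x)^{−k(|z|−Re z)} ≤ e^{Cπ/2} C_r x (log x)^{k(Re z−1)}` is `‖H_x(z)‖ ≤ e^{Cπ/2} C_r`). -/
theorem stub_bootstrapTransfer :
    (∀ (P : Polynomial ℂ) (r φ₀ φ₁ : ℝ) (b b' : ℝ → ℝ), 0 < r → φ₀ ≤ φ₁ →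
      (∀ φ ∈ Set.Icc φ₀ φ₁, HasDerivAt b (b' φ) φ) →
      ‖P.eval ((r : ℂ) * Complex.exp ((φ₀ : ℂ) * Complex.I))‖ ≤ Real.exp (b φ₀) →
      (∀ φ ∈ Set.Ioo φ₀ φ₁,
        Real.exp (b φ) < ‖P.eval ((r : ℂ) * Complex.exp ((φ : ℂ) * Complex.I))‖ →
          -(((r : ℂ) * Complex.exp ((φ : ℂ) * Complex.I) *
              (Polynomial.derivative P).eval ((r : ℂ) * Complex.exp ((φ : ℂ) * Complex.I)) /
              P.eval ((r : ℂ) * Complex.exp ((φ : ℂ) * Complex.I))).im) ≤ b' φ) →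
      ∀ φ ∈ Set.Icc φ₀ φ₁, ‖P.eval ((r : ℂ) * Complex.exp ((φ : ℂ) * Complex.I))‖ ≤ Real.exp (b φ)) →
    ∀ (k : ℕ) (f : Fin k → ℤ[X]) (η C K Cr : ℝ), 0 < η → η ≤ 1 / 4 → 0 ≤ K →
      (∀ x : ℕ, 3 ≤ x → ∀ r θ : ℝ, 0 < r → r ≤ 15 / 8 → |θ| < Real.pi / 2 → |r * Real.sin θ| < η →
        Real.exp (-K) * Real.log x ^ (-((k : ℝ) * r * (1 - Real.cos θ))) *
            (∑ n ∈ Finset.range (x + 1), r ^ Ωf f n) ≤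
          ‖∑ n ∈ Finset.range (x + 1), ((r : ℂ) * Complex.exp ((θ : ℂ) * Complex.I)) ^ Ωf f n‖ →
        (k : ℝ) * r * |Real.sin θ| * Real.log (Real.log x) - C ≤
          Real.sign θ *
            ((∑ n ∈ Finset.range (x + 1), (Ωf f n : ℂ) * ((r : ℂ) * Complex.exp ((θ : ℂ) * Complex.I)) ^ Ωf f n) /
              (∑ n ∈ Finset.range (x + 1), ((r : ℂ) * Complex.exp ((θ : ℂ) * Complex.I)) ^ Ωf f n)).im) →
      (∀ x : ℕ, 3 ≤ x → ∀ r : ℝ, 0 < r → r ≤ 15 / 8 →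
        ∑ n ∈ Finset.range (x + 1), r ^ Ωf f n ≤ Cr * x * Real.log x ^ ((k : ℝ) * (r - 1))) →
      ∃ M : ℝ, ∀ x : ℕ, 3 ≤ x → ∀ z : ℂ, 0 < z.re → z.re < 7 / 4 → |z.im| < η → ‖H k f x z‖ ≤ M := by
  intro hArc k f η C K Cr _hη hη4 hK hLB hCr
  refine ⟨Real.exp (max C 0 * (Real.pi / 2)) * max Cr 0, ?_⟩
  intro x hx z hz0 hz1 hzim
  -- WLOG `0 ≤ Im z` (conjugation symmetry of the family)
  wlog him : 0 ≤ z.im generalizing z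
  · have h := this ((starRingEnd ℂ) z) (by simpa using hz0) (by simpa using hz1)
      (by simpa using hzim) (by rw [Complex.conj_im]; linarith [not_le.mp him])
    rwa [bootstrapTransfer_H_conj, Complex.norm_conj] at h
  -- logarithms
  have hx3 : (3 : ℝ) ≤ x := by exact_mod_cast hx
  have hx0 : (0 : ℝ) < x := by linarith
  have hlog1 : 1 < Real.log x := by
    rw [Real.lt_log_iff_exp_lt hx0]
    have := Real.exp_one_lt_d9
    linarith
  have hlog0 : 0 < Real.log x := by linarith
  set L := Real.log (Real.log x) with hLdef
  have hL : 0 < L := Real.log_pos hlog1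
  -- polar form `z = r e^{iθ}`, `0 ≤ θ < π/2`, `0 < r ≤ 15/8`
  set r := ‖z‖ with hrdef
  set θ := Complex.arg z with hθdef
  have hz : z ≠ 0 := fun h => by simp [h] at hz0
  have hr : 0 < r := norm_pos_iff.mpr hz
  have hzeq : (r : ℂ) * Complex.exp ((θ : ℂ) * Complex.I) = z :=
    Complex.norm_mul_exp_arg_mul_I z
  have hcos : r * Real.cos θ = z.re := Complex.norm_mul_cos_arg z
  have hsin : r * Real.sin θ = z.im := Complex.norm_mul_sin_arg z
  have hθ2 : |θ| < Real.pi / 2 := Complex.abs_arg_lt_pi_div_two_iff.mpr (Or.inl hz0)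
  have hθ0 : 0 ≤ θ := Complex.arg_nonneg_iff.mpr him
  have hθle : θ ≤ Real.pi / 2 := (abs_lt.mp hθ2).2.le
  have hr158 : r ≤ 15 / 8 := by
    have h2 : r ^ 2 = z.re ^ 2 + z.im ^ 2 := by
      rw [Complex.sq_norm, Complex.normSq_apply]; ring
    have him4 : |z.im| < 1 / 4 := lt_of_lt_of_le hzim hη4
    have him2 : z.im ^ 2 < (1 / 4) ^ 2 := by
      have := abs_lt.mp him4
      nlinarith
    have hre2 : z.re ^ 2 < (7 / 4) ^ 2 := by nlinarith
    nlinarith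
  -- the real sum `S_x(r) > 0`
  set Sr : ℝ := ∑ n ∈ Finset.range (x + 1), r ^ Ωf f n with hSrdef
  have hSr : 0 < Sr := Finset.sum_pos (fun n _ => pow_pos hr _) ⟨0, by simp⟩
  -- the polynomial and the barrier
  set P : ℂ[X] := ∑ n ∈ Finset.range (x + 1), (X : ℂ[X]) ^ Ωf f n with hPdef
  set Cp := max C 0 with hCpdef
  have hCp0 : 0 ≤ Cp := le_max_right _ _
  have hCCp : C ≤ Cp := le_max_left _ _
  set b : ℝ → ℝ := fun φ => Real.log Sr + Cp * φ + L * -((k : ℝ) * r * (1 - Real.cos φ))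
    with hbdef
  set b' : ℝ → ℝ := fun φ => Cp + L * -((k : ℝ) * r * Real.sin φ) with hb'def
  have hexpb : ∀ φ : ℝ, Real.exp (b φ) =
      Sr * Real.exp (Cp * φ) * Real.exp (L * -((k : ℝ) * r * (1 - Real.cos φ))) := by
    intro φ
    simp only [hbdef]
    rw [Real.exp_add, Real.exp_add, Real.exp_log hSr]
  have hbder : ∀ φ ∈ Set.Icc (0 : ℝ) θ, HasDerivAt b (b' φ) φ := by
    intro φ _
    have h1 : HasDerivAt (fun φ : ℝ => Cp * φ) Cp φ := hasDerivAt_const_mul Cp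
    have h2 : HasDerivAt (fun φ : ℝ => 1 - Real.cos φ) (Real.sin φ) φ := by
      simpa using (Real.hasDerivAt_cos φ).const_sub 1
    exact (h1.const_add (Real.log Sr)).fun_add
      (((h2.const_mul ((k : ℝ) * r)).fun_neg).const_mul L)
  have hstart :
      ‖P.eval ((r : ℂ) * Complex.exp (((0 : ℝ) : ℂ) * Complex.I))‖ ≤
        Real.exp (b 0) := by
    have h1 : (r : ℂ) * Complex.exp (((0 : ℝ) : ℂ) * Complex.I) = (r : ℂ) := by simp
    have h2 : P.eval (r : ℂ) = ((Sr : ℝ) : ℂ) := by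
      rw [hPdef, bootstrapTransfer_eval, hSrdef, Complex.ofReal_sum]
      simp only [Complex.ofReal_pow]
    have h3 : Real.exp (b 0) = Sr := by
      rw [hexpb]
      simp
    rw [h1, h2, Complex.norm_real, Real.norm_of_nonneg hSr.le, h3]
  have hstep : ∀ φ ∈ Set.Ioo (0 : ℝ) θ,
      Real.exp (b φ) < ‖P.eval ((r : ℂ) * Complex.exp ((φ : ℂ) * Complex.I))‖ →
        -(((r : ℂ) * Complex.exp ((φ : ℂ) * Complex.I) *
            (derivative P).eval ((r : ℂ) * Complex.exp ((φ : ℂ) * Complex.I)) /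
            P.eval ((r : ℂ) * Complex.exp ((φ : ℂ) * Complex.I))).im) ≤ b' φ := by
    intro φ hφ hlt
    obtain ⟨hφ0, hφθ⟩ := hφ
    rw [hPdef, bootstrapTransfer_mul_derivative_eval, bootstrapTransfer_eval]
    rw [hPdef, bootstrapTransfer_eval] at hlt
    have hφ2 : |φ| < Real.pi / 2 := by
      rw [abs_of_pos hφ0]
      linarith
    have hsinφ0 : 0 ≤ Real.sin φ :=
      Real.sin_nonneg_of_nonneg_of_le_pi hφ0.le (by linarith [Real.pi_pos])
    have hsinle : Real.sin φ ≤ Real.sin θ :=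
      Real.sin_le_sin_of_le_of_le_pi_div_two (by linarith [Real.pi_pos]) hθle hφθ.le
    have hrs : |r * Real.sin φ| < η := by
      rw [abs_of_nonneg (mul_nonneg hr.le hsinφ0)]
      calc r * Real.sin φ ≤ r * Real.sin θ := mul_le_mul_of_nonneg_left hsinle hr.le
        _ = z.im := hsin
        _ ≤ |z.im| := le_abs_self _
        _ < η := hzim
    -- the proviso of the phase-velocity lower bound holds above the barrier
    have hprov : Real.exp (-K) * Real.log x ^ (-((k : ℝ) * r * (1 - Real.cos φ))) * Sr ≤
        ‖∑ n ∈ Finset.range (x + 1),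
          ((r : ℂ) * Complex.exp ((φ : ℂ) * Complex.I)) ^ Ωf f n‖ := by
      refine le_trans ?_ hlt.le
      rw [hexpb, Real.rpow_def_of_pos hlog0, ← hLdef]
      have hK1 : Real.exp (-K) ≤ 1 := Real.exp_le_one_iff.mpr (by linarith)
      have hC1 : 1 ≤ Real.exp (Cp * φ) := Real.one_le_exp (mul_nonneg hCp0 hφ0.le)
      have hE := Real.exp_pos (L * -((k : ℝ) * r * (1 - Real.cos φ)))
      calc Real.exp (-K) * Real.exp (L * -((k : ℝ) * r * (1 - Real.cos φ))) * Sr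
          ≤ 1 * Real.exp (L * -((k : ℝ) * r * (1 - Real.cos φ))) * Sr := by gcongr
        _ = Sr * 1 * Real.exp (L * -((k : ℝ) * r * (1 - Real.cos φ))) := by ring
        _ ≤ Sr * Real.exp (Cp * φ) * Real.exp (L * -((k : ℝ) * r * (1 - Real.cos φ))) := by
          gcongr
    have hmain := hLB x hx r φ hr hr158 hφ2 hrs hprov
    rw [Real.sign_of_pos hφ0, one_mul, abs_of_nonneg hsinφ0, ← hLdef] at hmain
    simp only [hb'def]
    linarith [hmain, hCCp]
  -- the arc barrier, from `φ = 0` to `φ = θ`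
  have key := hArc P r 0 θ b b' hr hθ0 hbder hstart hstep θ ⟨hθ0, le_rfl⟩
  rw [hzeq, hPdef, bootstrapTransfer_eval] at key
  -- the real-axis order of magnitude
  have hCr' : Sr ≤ Cr * x * Real.exp (L * ((k : ℝ) * (r - 1))) := by
    have := hCr x hx r hr hr158
    rwa [Real.rpow_def_of_pos hlog0, ← hLdef] at this
  have hexp1 : Real.exp ((k : ℝ) * (1 - z.re) * L) * Real.exp (L * ((k : ℝ) * (r - 1))) *
      Real.exp (L * -((k : ℝ) * r * (1 - Real.cos θ))) = 1 := by
    rw [← Real.exp_add, ← Real.exp_add, Real.exp_eq_one_iff]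
    linear_combination ((k : ℝ) * L) * hcos
  rw [bootstrapTransfer_norm_H, ← hLdef]
  calc (x : ℝ)⁻¹ * Real.exp ((k : ℝ) * (1 - z.re) * L) *
        ‖∑ n ∈ Finset.range (x + 1), z ^ Ωf f n‖
      ≤ (x : ℝ)⁻¹ * Real.exp ((k : ℝ) * (1 - z.re) * L) *
          (Cr * x * Real.exp (L * ((k : ℝ) * (r - 1))) * Real.exp (Cp * θ) *
            Real.exp (L * -((k : ℝ) * r * (1 - Real.cos θ)))) := by
        gcongr
        calc ‖∑ n ∈ Finset.range (x + 1), z ^ Ωf f n‖ ≤ Real.exp (b θ) := key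
          _ = Sr * Real.exp (Cp * θ) * Real.exp (L * -((k : ℝ) * r * (1 - Real.cos θ))) :=
            hexpb θ
          _ ≤ Cr * x * Real.exp (L * ((k : ℝ) * (r - 1))) * Real.exp (Cp * θ) *
                Real.exp (L * -((k : ℝ) * r * (1 - Real.cos θ))) := by gcongr
    _ = Cr * Real.exp (Cp * θ) * ((x : ℝ)⁻¹ * x) *
          (Real.exp ((k : ℝ) * (1 - z.re) * L) * Real.exp (L * ((k : ℝ) * (r - 1))) *
            Real.exp (L * -((k : ℝ) * r * (1 - Real.cos θ)))) := by ring
    _ = Cr * Real.exp (Cp * θ) := by rw [hexp1, inv_mul_cancel₀ hx0.ne', mul_one, mul_one]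
    _ ≤ max Cr 0 * Real.exp (Cp * θ) := by gcongr; exact le_max_left _ _
    _ ≤ max Cr 0 * Real.exp (Cp * (Real.pi / 2)) := by gcongr
    _ = Real.exp (Cp * (Real.pi / 2)) * max Cr 0 := mul_comm _ _

end

end Summit.Parity.BatemanHorn.Cruxes.NormalFamilyBound.RenewalPhaseBootstrap
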